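import Summits.BirchSwinnertonDyer.BirchSwinnertonDyer.Theorems.ByReductionTypeAtTwoOrdKatoHalfAtTwoIsoHabitatThm124AtTwo
import Summits.BirchSwinnertonDyer.BirchSwinnertonDyer.Theorems.ByReductionTypeAtTwoAdditiveKatoEulerSystemClassNeZeroAtTwo
import HarnessLib

/-!
# Route ByReductionTypeAtTwo, crux `OrdKatoHalfAtTwoIso` (stmt-BirchSwinnertonDyer-19573), line `steinberg-fibre-at-two`,
# F1 slot (child stmt-BirchSwinnertonDyer-24097): **MU13⁻ ⟹ EVERY clause of Kato's Thm. 12.4 at `p = 2` at EVERY pin of the `Δ < 0` cell,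
# in EVERY analytic rank, modulo Kato's construction fact alone** — the `[Nontrivial 𝐇¹_Γ(T₂W)]` hypothesis of w3 g9's
# `thm12_4_clauses_of_zetaQuotientMuZero_of_nontrivial` DISCHARGED by the cell's `p = 2` Rohrlich port (addL2x GEN 20, p744189)

Seat `cruxlead-stmt-BirchSwinnertonDyer-19573-w3` g10 (prover WIDTH; LEAD lineage SUMMON-only; HOME `run/shared/lean/pub/bsd-2adic/`;
`--supports` stmt-BirchSwinnertonDyer-24097). THEOREMS ONLY (no definition, no named fact, no `sorry`, no instance). HONEST FRAMING (cell
bsd-2adic): BSD is not proved by any of this; nothing is closed; the research content of the F1 slot (G11⁺, G11⁻, N2D⁻) is untouched.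

WHY. w3 g9 (`…HabitatThm124AtTwo`, p743969) showed that the memo stub MU13⁻ (`ZetaQuotientMuZeroTwoOrdNegDisc`: a genuine `2`-adic Euler-system
class `z` with `μ(𝐇¹_Γ(T₂W) ⧸ Λz) = 0` at every pin of the `Δ < 0` cell) carries the UPPER half of Kato Thm. 12.4 (2) (`rank_Λ 𝐇¹_Γ ≤ 1`, weak
Leopoldt at `2`), and that together with the LOWER half `𝐇¹_Γ(T₂W) ≠ 0` it yields every clause of the named fact `Kato2004.thm12_4` at that pin;
the lower half was discharged there only on the HABITAT (`r_an = 0`, where `L(W,1) ≠ 0` makes the bottom Kato class non-zero) and left as the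
display hypothesis `[Nontrivial I.H]` in general («in every analytic rank it is the `p = 2` Rohrlich non-vanishing under way elsewhere in the
cell»). That port has LANDED: `AddKatoTwo.nontrivial_iwasawaH1_two` (cell seat addL2x GEN 20, p744189; Kato Thm. 12.5 (1) at `p = 2` with
Rohrlich's theorem fed from the KERNEL `PSRohrlichAtLevel.rohrlich_primePow_of_isNewformOf`, any level) gives `𝐇¹_Γ(T₂W) ≠ 0` for EVERY elliptic
`W` with `W[2]` irreducible and a newform, every cyclotomic `κ`, every pin, modulo the ONE construction fact
`Kato2004.exists_eulerSystem_expStar_values`. This file is the 1-step consumer named in w3 g9's HANDOFF (key K1):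

* §1 `thm12_4_clauses_of_zetaQuotientMuZero` — MU13⁻ + `hES` + a newform `f` of `W` ⟹ at every curve of the `Δ < 0` cell [good ordinary at `2`,
  `ρ̄₂` onto, `Δ < 0`], every normalised cyclotomic pair `(κ, γ)` and EVERY pin `I`: `𝐇¹_Γ(T₂W)` is finitely generated, torsion free of Λ-rank `1`,
  free of finrank `1` (all clauses of `Kato2004.thm12_4` at `(W, 2, κ, γ, I)`), ANY analytic rank; `…_of_pub` — the newform from the line's PUB
  item (modularity); `exists_generator_of_zetaQuotientMuZero` — a generator `e ≠ 0`, `𝐇¹_Γ = Λ·e`.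
* §2 `moduleFinite_quotient_span_iff_not_mem_smul_top_of_zetaQuotientMuZero` — under MU13⁻ (+ `hES`, newform), at every pin of the cell and for
  EVERY class `z'`: `μ(𝐇¹_Γ ⧸ Λz') = 0 ⟺ z' ∉ 2·𝐇¹_Γ` (the MU13/N2D dictionary of w3 g7 with `thm12_4` replaced by MU13⁻ + `hES`);
  `nontrivial_iwasawaH1_two_of_negDiscCell` — the lower half on the cell by name (`ρ̄₂` onto ⟹ `W[2]` irreducible).
PRICING (for the LEAD / triage; no statement of the line changes): on the `Δ < 0` cell, wherever a door takes `(h12 : Kato2004.thm12_4)` ONLY for the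
clauses at `p = 2` on this cell AND MU13⁻ is among its hypotheses, `h12` can be fed from MU13⁻ + `hES` + PUB by §1 — e.g. the `(⇐)` direction
N2D⁻ ⟹ MU13⁻ of w3 g7's dictionary is NOT such a door (it needs `rank ≤ 1` BEFORE MU13⁻ is known), whereas every use of `h12` downstream of an
MU13⁻ hypothesis is.

References: [Kato2004Asterisque] §12.2 (12.2.1)–(12.2.2) (p. 220), Thm. 12.4 (2)(3) (p. 221), Thm. 12.5 (1) (pp. 221–222), Ex. 13.3 (p. 225), Thm. 13.4 (i)
(p. 226), §13.8 (pp. 228–229); [RohrlichInventiones1984] Theorem (p. 409); [GreenbergLNM1716] Conj. 1.11 (p. 64); tree: w3 g9 p743969 `…HabitatThm124AtTwo`,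
addL2x GEN 20 p744189 `…AdditiveKatoEulerSystemClassNeZeroAtTwo`, w3 g7 p738189/p738787.
-/

set_option autoImplicit false
set_option linter.dupNamespace false

noncomputable section

open scoped Classical MatrixGroups ModularForm NumberField
open CongruenceSubgroup WeierstrassCurve Field IsDedekindDomain NumberField
open Literature.NumberTheory.GaloisRepresentations
open Literature.NumberTheory.GaloisCohomology
open Literature.NumberTheory.EllipticCurves Literature.NumberTheory.EllipticCurves.ModularForms
  Literature.NumberTheory.EllipticCurves.GreenbergSelmer
open Literature.NumberTheory.EllipticCurves.Kato2004
  Literature.NumberTheory.EllipticCurves.Kato2004.EulerSystemValues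
open Literature.NumberTheory.EllipticCurves.IwasawaDual
open Literature.NumberTheory.EllipticCurves.Rank1Residual
open Literature.NumberTheory.EllipticCurves.Greenberg1999
open Summit.BirchSwinnertonDyer.Rank1Residual Summit.BirchSwinnertonDyer.Rank1Residual.X5
open Summit.BirchSwinnertonDyer.BirchSwinnertonDyer.Theses.ByReductionTypeAtTwo

namespace Summit.BirchSwinnertonDyer.BirchSwinnertonDyer.Theorems.SteinbergFibreAtTwo

/-! ## §1 MU13⁻ ⟹ every clause of `thm12_4` at every pin of the `Δ < 0` cell, every analytic rank -/

/-- **The lower half `𝐇¹_Γ(T₂W) ≠ 0` on the `Δ < 0` cell by name** (in fact on every curve with `ρ̄₂` onto; the cell binders are not used):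
`ρ̄_{W,2}` onto ⟹ `W[2]` irreducible, and the cell's `p = 2` Rohrlich port `AddKatoTwo.nontrivial_iwasawaH1_two` (addL2x GEN 20) gives a NON-ZERO genuine
`2`-adic Euler-system class in every pinned `𝐇¹_Γ(T₂W)` over a cyclotomic `κ`, granted Kato's construction fact and a newform of `W` — EVERY analytic rank.
[cite: Kato2004Asterisque, Thm. 12.5 (1) (pp. 221–222), §12.2 (12.2.2) (p. 220)] [cite: RohrlichInventiones1984, Theorem (p. 409)] -/
theorem nontrivial_iwasawaH1_two_of_negDiscCell (hES : Kato2004.exists_eulerSystem_expStar_values)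
    (W : WeierstrassCurve ℚ) [W.IsElliptic] [ContinuousSMul ℤ_[2] (W.tateModule 2)] [Module.Free ℤ_[2] (W.tateModule 2)]
    [Module.Finite ℤ_[2] (W.tateModule 2)] {N : ℕ} [NeZero N] (f : CuspForm (Gamma0 N) 2) (hf : IsNewformOf W f)
    (h2 : W.HasSurjectiveModNGaloisRep 2) {κ : ZpExtension ℚ 2} {γ : absoluteGaloisGroup ℚ} (hκ : κ.IsCyclotomic)
    (I : IwasawaH1Data W 2 κ γ) : Nontrivial I.H :=
  AddKatoTwo.nontrivial_iwasawaH1_two W I hκ hES (hasIrreducibleModPGaloisRep_of_hasSurjectiveModNGaloisRep W 2 h2) f hf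

/-- **MU13⁻ ⟹ EVERY clause of `Kato2004.thm12_4` at `p = 2` at EVERY pin of the `Δ < 0` cell, in EVERY analytic rank, modulo the construction
fact.** If `ZetaQuotientMuZeroTwoOrdNegDisc` holds then for every curve of the cell [globally minimal, good ordinary at `2`, `ρ̄₂` onto, `Δ < 0`] with a
newform `f`, every cyclotomic `κ` with normalised topological generator `γ` and every pin `I : IwasawaH1Data W 2 κ γ`: `𝐇¹_Γ(T₂W)` is finitely generated,
torsion free of Λ-rank `1`, free of finrank `1` — upper half from MU13⁻ (w3 g9 `rank_le_one_of_zetaQuotientMuZero`), lower half from the Rohrlich port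
(`nontrivial_iwasawaH1_two_of_negDiscCell`), the clauses by w3 g9's `thm12_4_clauses_pin_of_rank_le_one_of_nontrivial`. CONDITIONAL on MU13⁻ (memo tier,
OPEN) and `hES`; nothing closed. [cite: Kato2004Asterisque, §12.2 (12.2.1) (p. 220), Thm. 12.4 (2)(3) (p. 221), Thm. 12.5 (1) (pp. 221–222)] -/
theorem thm12_4_clauses_of_zetaQuotientMuZero (hMU : ZetaQuotientMuZeroTwoOrdNegDisc)
    (hES : Kato2004.exists_eulerSystem_expStar_values)
    (W : WeierstrassCurve ℚ) [W.IsElliptic] [W.IsGloballyMinimal]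
    [ContinuousSMul ℤ_[2] (W.tateModule 2)] [Module.Free ℤ_[2] (W.tateModule 2)] [Module.Finite ℤ_[2] (W.tateModule 2)]
    {N : ℕ} [NeZero N] (f : CuspForm (Gamma0 N) 2) (hf : IsNewformOf W f)
    (κ : ZpExtension ℚ 2) (γ : absoluteGaloisGroup ℚ) (hκ : κ.IsCyclotomic) (hγ : κ.IsTopGenerator γ)
    (hΔ : W.Δ < 0) (hord : IsOrdinaryAt W 2) (h2 : W.HasSurjectiveModNGaloisRep 2) (hγ' : IsCyclotomicVariable 2 γ)
    (I : IwasawaH1Data W 2 κ γ) :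
    Module.Finite (IwasawaAlgebra 2) I.H ∧
      (Module.IsTorsionFree (IwasawaAlgebra 2) I.H ∧ Module.rank (IwasawaAlgebra 2) I.H = 1) ∧
      (Module.Free (IwasawaAlgebra 2) I.H ∧ Module.finrank (IwasawaAlgebra 2) I.H = 1) := by
  haveI := nontrivial_iwasawaH1_two_of_negDiscCell hES W f hf h2 hκ I
  exact thm12_4_clauses_of_zetaQuotientMuZero_of_nontrivial hMU W κ γ hκ hγ hΔ hord h2 hγ' I

/-- **The same with the newform taken from the line's PUB item** `OrdPublishedInputsAtTwo` (first conjunct: modularity): MU13⁻ + `hES` + PUB ⟹ every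
clause of `thm12_4` at `p = 2` at every pin of the `Δ < 0` cell, every analytic rank. CONDITIONAL; nothing closed.
[cite: Kato2004Asterisque, Thm. 12.4 (2)(3) (p. 221), Thm. 12.5 (1) (pp. 221–222)] [cite: BreuilConradDiamondTaylor2001, Thm. A] -/
theorem thm12_4_clauses_of_zetaQuotientMuZero_of_pub (hMU : ZetaQuotientMuZeroTwoOrdNegDisc)
    (hES : Kato2004.exists_eulerSystem_expStar_values) (hPub : OrdPublishedInputsAtTwo)
    (W : WeierstrassCurve ℚ) [W.IsElliptic] [W.IsGloballyMinimal]
    [ContinuousSMul ℤ_[2] (W.tateModule 2)] [Module.Free ℤ_[2] (W.tateModule 2)] [Module.Finite ℤ_[2] (W.tateModule 2)]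
    (κ : ZpExtension ℚ 2) (γ : absoluteGaloisGroup ℚ) (hκ : κ.IsCyclotomic) (hγ : κ.IsTopGenerator γ)
    (hΔ : W.Δ < 0) (hord : IsOrdinaryAt W 2) (h2 : W.HasSurjectiveModNGaloisRep 2) (hγ' : IsCyclotomicVariable 2 γ)
    (I : IwasawaH1Data W 2 κ γ) :
    Module.Finite (IwasawaAlgebra 2) I.H ∧
      (Module.IsTorsionFree (IwasawaAlgebra 2) I.H ∧ Module.rank (IwasawaAlgebra 2) I.H = 1) ∧
      (Module.Free (IwasawaAlgebra 2) I.H ∧ Module.finrank (IwasawaAlgebra 2) I.H = 1) := by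
  obtain ⟨hmod, -, -, -⟩ := hPub
  haveI : NeZero (W.conductorNorm ℤ) := ⟨(W.conductorNorm_pos_holds).ne'⟩
  obtain ⟨Dm⟩ := hmod W
  exact thm12_4_clauses_of_zetaQuotientMuZero hMU hES W Dm.f Dm.isNewformOf κ γ hκ hγ hΔ hord h2 hγ' I

/-- **A generator of `𝐇¹_Γ(T₂W)` at every pin of the `Δ < 0` cell from MU13⁻ + `hES`** (`∃ e ≠ 0, 𝐇¹_Γ = Λ·e`), every analytic rank.
[cite: Kato2004Asterisque, Thm. 12.4 (2)(3) (p. 221)] -/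
theorem exists_generator_of_zetaQuotientMuZero (hMU : ZetaQuotientMuZeroTwoOrdNegDisc)
    (hES : Kato2004.exists_eulerSystem_expStar_values)
    (W : WeierstrassCurve ℚ) [W.IsElliptic] [W.IsGloballyMinimal]
    [ContinuousSMul ℤ_[2] (W.tateModule 2)] [Module.Free ℤ_[2] (W.tateModule 2)] [Module.Finite ℤ_[2] (W.tateModule 2)]
    {N : ℕ} [NeZero N] (f : CuspForm (Gamma0 N) 2) (hf : IsNewformOf W f)
    (κ : ZpExtension ℚ 2) (γ : absoluteGaloisGroup ℚ) (hκ : κ.IsCyclotomic) (hγ : κ.IsTopGenerator γ)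
    (hΔ : W.Δ < 0) (hord : IsOrdinaryAt W 2) (h2 : W.HasSurjectiveModNGaloisRep 2) (hγ' : IsCyclotomicVariable 2 γ)
    (I : IwasawaH1Data W 2 κ γ) :
    ∃ e : I.H, e ≠ 0 ∧ ∀ x : I.H, ∃ a : IwasawaAlgebra 2, x = a • e := by
  haveI := nontrivial_iwasawaH1_two_of_negDiscCell hES W f hf h2 hκ I
  exact exists_generator_pin_of_rank_le_one_of_nontrivial hκ hγ I (hasIrreducibleModPGaloisRep_of_hasSurjectiveModNGaloisRep W 2 h2)
    (rank_le_one_of_zetaQuotientMuZero hMU W κ γ hκ hγ hΔ hord h2 hγ' I)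

/-! ## §2 The MU13/N2D dictionary at every pin of the cell, modulo MU13⁻ + the construction fact -/

/-- **Under MU13⁻ (+ `hES`, a newform): at every pin of the `Δ < 0` cell and for EVERY class `z'`, `μ(𝐇¹_Γ ⧸ Λz') = 0 ⟺ z' ∉ 2·𝐇¹_Γ`** — w3 g7's
`IwasawaH1Data.moduleFinite_quotient_span_iff_not_mem_smul_top` with `thm12_4` replaced by MU13⁻ (upper half) + the Rohrlich port (lower half),
every analytic rank. CONDITIONAL; nothing closed. [cite: Kato2004Asterisque, Thm. 12.4 (2)(3) (p. 221), §13.8 (pp. 228–229)] -/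
theorem moduleFinite_quotient_span_iff_not_mem_smul_top_of_zetaQuotientMuZero (hMU : ZetaQuotientMuZeroTwoOrdNegDisc)
    (hES : Kato2004.exists_eulerSystem_expStar_values)
    (W : WeierstrassCurve ℚ) [W.IsElliptic] [W.IsGloballyMinimal]
    [ContinuousSMul ℤ_[2] (W.tateModule 2)] [Module.Free ℤ_[2] (W.tateModule 2)] [Module.Finite ℤ_[2] (W.tateModule 2)]
    {N : ℕ} [NeZero N] (f : CuspForm (Gamma0 N) 2) (hf : IsNewformOf W f)
    (κ : ZpExtension ℚ 2) (γ : absoluteGaloisGroup ℚ) (hκ : κ.IsCyclotomic) (hγ : κ.IsTopGenerator γ)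
    (hΔ : W.Δ < 0) (hord : IsOrdinaryAt W 2) (h2 : W.HasSurjectiveModNGaloisRep 2) (hγ' : IsCyclotomicVariable 2 γ)
    (I : IwasawaH1Data W 2 κ γ) (z' : I.H) :
    Module.Finite ℤ_[2] (RestrictScalars ℤ_[2] (IwasawaAlgebra 2) (I.H ⧸ (IwasawaAlgebra 2) ∙ z')) ↔
      z' ∉ IwasawaAlgebra.augIdealP 2 • (⊤ : Submodule (IwasawaAlgebra 2) I.H) := by
  haveI := nontrivial_iwasawaH1_two_of_negDiscCell hES W f hf h2 hκ I
  exact moduleFinite_quotient_span_iff_not_mem_smul_top_pin_of_rank_le_one_of_nontrivial hκ hγ I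
    (hasIrreducibleModPGaloisRep_of_hasSurjectiveModNGaloisRep W 2 h2) (rank_le_one_of_zetaQuotientMuZero hMU W κ γ hκ hγ hΔ hord h2 hγ' I) z'

end Summit.BirchSwinnertonDyer.BirchSwinnertonDyer.Theorems.SteinbergFibreAtTwo

end
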